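import Literature.Computability.MetaComplexity.HegedusLemma
import HarnessLib

/-!
# Cell qa-qnc0 (rung F-Q1, route RingFrame, crux α, line `product`): rooted covering and layer
# growth for supports of low-degree `𝔽₂`-polynomials (from Hegedűs's lemma)

Planner statements HOME/qa-qnc0-p1/Sketch5.lean §18.4 (`RootedCovering`, `LayerGrowth`, marked
"PROVED in prose from `hegedus_exact_F2`"), now kernel theorems, literally in the planner's shapes.
Let `g : {0,1}ⁿ → 𝔽₂` have degree `≤ d < q = 2^j`.

* `rootedCovering` (`RootedCovering`): if `g(b) ≠ 0` and `Z` is a set of `2q` zero-coordinates of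
  `b`, some `q`-subset `S ⊆ Z` has `g(b + 1_S) ≠ 0`.  Proof: the function `T ↦ g(b + 1_{Z∖T})` on the
  `2q`-cube `{T ⊆ Z}` has degree `≤ d` (substitution + complementation, tree lemmas
  `Smolensky.comp_subst_mem_lowDeg`, `Hegedus.cpl_mem_lowDeg`) and is non-zero at the top point
  `T = Z`; by Hegedűs's lemma (tree theorem `Hegedus.hegedus_exact_F2`, layers `q → 2q`) it cannot
  vanish on the whole layer `|T| = q`.
* `layerGrowth` (`LayerGrowth`): `|B_k|·C(n−k, q) ≤ |B_{k+q}|·C(k+q, q)·C(2q, q)` for `k + 2q ≤ n`,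
  where `B_m = {u : g u ≠ 0, |u| = m}`.  Proof: double counting — for `b ∈ B_k` (with `z = n − k`
  zeros) every `2q`-set of zeros contains a good `q`-set (`rootedCovering`) and a `q`-set lies in
  `C(z−q, q)` such `2q`-sets, so `b` has `≥ C(z,2q)/C(z−q,q) = C(z,q)/C(2q,q)` good `q`-sets
  (`Nat.choose_mul`); the map `(b, S) ↦ b + 1_S ∈ B_{k+q}` has fibres of size `≤ C(k+q, q)`.

These are the cell's statements (qa-qnc0 TARGET.md §18.4), not in print; the library input is
Hegedűs's lemma [Hegedűs 2010; Srinivasan 2023, Lemma 1.1].  They feed `WeakPLDAMSq` (weak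
proportional residue avoidance at every degree, `κ₀ = 2^{−O(d)}`), the unconditional rung of the
line `product`.  WHAT THIS IS NOT: nothing on `LDMAPolylog` or on α; no separation.

## References

* G. Hegedűs, *Balancing sets of vectors*, Studia Sci. Math. Hungar. 47 (2010) 333–349 [Hegedus2010].
* S. Srinivasan, *A robust version of Hegedűs's lemma, with applications*, TheoretiCS 2 (2023),
  Lemma 1.1 [Srinivasan2023].
-/

noncomputable section

namespace Summit.QuantumAdvantage.AdviceFreeQNC0

open Finset
open Literature.Computability.MetaComplexity Literature.Computability.MetaComplexity.Smolensky
open Literature.Computability.MetaComplexity.Hegedus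

variable {n : ℕ}

/-! ### Flipping a set of zero coordinates -/

/-- `|b + 1_S| = |b| + |S|` when `S` consists of zero coordinates of `b`. [folklore] -/
theorem wt_flip_eq_add {b : Fin n → Bool} {S : Finset (Fin n)} (hS : ∀ i ∈ S, b i = false) :
    wt (fun i => if i ∈ S then true else b i) = wt b + S.card := by
  classical
  unfold wt
  have hset : (univ.filter fun i : Fin n => (if i ∈ S then true else b i) = true) =
      (univ.filter fun i : Fin n => b i = true) ∪ S := by
    ext i
    simp only [Finset.mem_filter, Finset.mem_univ, true_and, Finset.mem_union]
    by_cases hi : i ∈ S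
    · simp [hi]
    · simp [hi]
  rw [hset, Finset.card_union_of_disjoint]
  exact Finset.disjoint_left.2 fun i hi hiS => by
    have := (Finset.mem_filter.1 hi).2
    rw [hS i hiS] at this
    exact Bool.false_ne_true this

/-- The weight of the all-ones point of `{0,1}^N` is `N`. [folklore] -/
theorem wt_const_true (N : ℕ) : wt (fun _ : Fin N => true) = N := by
  unfold wt
  simp

/-- `|w| + #{k : w k = false} = N`. [folklore] -/
theorem wt_add_card_false (N : ℕ) (w : Fin N → Bool) :
    wt w + (univ.filter fun k : Fin N => w k = false).card = N := by
  unfold wt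
  have h := Finset.card_filter_add_card_filter_not (s := (univ : Finset (Fin N))) (fun k => w k = true)
  have hset : (univ.filter fun k : Fin N => ¬w k = true) = univ.filter fun k : Fin N => w k = false :=
    Finset.filter_congr fun k _ => by simp
  rw [hset, Finset.card_univ, Fintype.card_fin] at h
  exact h

/-! ### Rooted covering -/

/-- **`RootedCovering` (planner Sketch5 §18.4), literally.** `g(b) ≠ 0`, `deg g ≤ d < 2^j`, `Z` a set
of `2·2^j` zero coordinates of `b` ⟹ some `2^j`-subset `S ⊆ Z` has `g(b + 1_S) ≠ 0`.  (Hegedűs's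
lemma on the `2q`-cube `{b + 1_T : T ⊆ Z}` applied to the reflected polynomial, non-zero at the
top.) [cite: Srinivasan2023, Lemma 1.1 (Hegedűs's lemma)] -/
theorem rootedCovering :
    ∀ n j d : ℕ, d < 2 ^ j → ∀ g : CubeFn (ZMod 2) n, g ∈ lowDeg (ZMod 2) n d →
      ∀ b : Fin n → Bool, g b ≠ 0 → ∀ Z : Finset (Fin n), (∀ i ∈ Z, b i = false) → Z.card = 2 * 2 ^ j →
        ∃ S : Finset (Fin n), S ⊆ Z ∧ S.card = 2 ^ j ∧ g (fun i => if i ∈ S then true else b i) ≠ 0 := by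
  intro n j d hd g hg b hb Z hZb hZ
  classical
  -- the `N = 2q`-cube on the coordinates `Z`
  set N := Z.card with hN
  set idx : ↥Z ≃ Fin N := Z.equivFin with hidx
  set emb : (Fin N → Bool) → (Fin n → Bool) :=
    fun w i => if h : i ∈ Z then w (idx ⟨i, h⟩) else b i with hemb
  have hembDeg : (fun w => g (emb w)) ∈ lowDeg (ZMod 2) N d := by
    refine comp_subst_mem_lowDeg emb (fun i => ?_) hg
    by_cases h : i ∈ Z
    · exact Or.inr ⟨idx ⟨i, h⟩, fun w => by simp [hemb, h]⟩
    · exact Or.inl ⟨b i, fun w => by simp [hemb, h]⟩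
  -- complement the cube variables: `h w = g (emb ¬w)`; the top point goes to `b`
  have hhDeg : cpl (fun w => g (emb w)) ∈ lowDeg (ZMod 2) N d := cpl_mem_lowDeg hembDeg
  have hcpl : ∀ w : Fin N → Bool, cpl (fun w => g (emb w)) w = g (emb fun k => !w k) := fun w => rfl
  have htop : emb (fun k => !(fun _ : Fin N => true) k) = b := by
    funext i
    simp only [hemb, Bool.not_true]
    split_ifs with hi
    · exact (hZb i hi).symm
    · rfl
  -- Hegedűs: the reflected polynomial cannot vanish on the layer `q`
  have hex : ∃ w : Fin N → Bool, wt w = 2 ^ j ∧ cpl (fun w => g (emb w)) w ≠ 0 := by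
    by_contra hnone
    push Not at hnone
    have hvan := hegedus_exact_F2 N j (2 ^ j) d hd le_rfl (by omega) _ hhDeg hnone (fun _ => true)
      (by rw [wt_const_true]; omega)
    rw [hcpl, htop] at hvan
    exact hb hvan
  obtain ⟨w, hwq, hw⟩ := hex
  rw [hcpl] at hw
  -- `S` = the coordinates of `Z` where `w` is `false`
  let F0 : Finset (Fin N) := univ.filter fun k => w k = false
  let ι : Fin N ↪ Fin n := ⟨fun k => (idx.symm k).1, fun k k' h => idx.symm.injective (Subtype.ext h)⟩
  refine ⟨F0.map ι, ?_, ?_, ?_⟩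
  · intro i hi
    obtain ⟨k, -, rfl⟩ := Finset.mem_map.1 hi
    exact (idx.symm k).2
  · rw [Finset.card_map]
    have h1 := wt_add_card_false N w
    change (univ.filter fun k : Fin N => w k = false).card = 2 ^ j
    omega
  · have hpt : (fun i => if i ∈ F0.map ι then true else b i) = emb fun k => !w k := by
      funext i
      by_cases hiZ : i ∈ Z
      · have hmem : i ∈ F0.map ι ↔ w (idx ⟨i, hiZ⟩) = false := by
          constructor
          · intro hi
            obtain ⟨k, hk, hki⟩ := Finset.mem_map.1 hi
            have hk' : (idx.symm k) = ⟨i, hiZ⟩ := Subtype.ext hki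
            have : k = idx ⟨i, hiZ⟩ := by rw [← hk', Equiv.apply_symm_apply]
            rw [← this]
            exact (Finset.mem_filter.1 hk).2
          · intro hw0
            exact Finset.mem_map.2 ⟨idx ⟨i, hiZ⟩, Finset.mem_filter.2 ⟨Finset.mem_univ _, hw0⟩,
              by simp [ι]⟩
        simp only [hemb, hiZ, dite_true]
        by_cases hw0 : w (idx ⟨i, hiZ⟩) = false
        · rw [if_pos (hmem.2 hw0), hw0]; rfl
        · rw [if_neg (fun h => hw0 (hmem.1 h))]
          rw [Bool.not_eq_false] at hw0
          rw [hw0, hZb i hiZ]; rfl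
      · have hni : i ∉ F0.map ι := fun hi => by
          obtain ⟨k, -, rfl⟩ := Finset.mem_map.1 hi
          exact hiZ (idx.symm k).2
        simp only [hemb, hiZ, dite_false, hni, if_false]
    rw [hpt]
    exact hw

/-! ### Layer growth -/

/-- **`LayerGrowth` (planner Sketch5 §18.4), literally.** For `deg g ≤ d < q = 2^j` and
`k + 2q ≤ n`: `|B_k|·C(n−k, q) ≤ |B_{k+q}|·C(k+q, q)·C(2q, q)`, `B_m = {u : g u ≠ 0, |u| = m}`.
(Double counting of the pairs `(b, S)`, `b ∈ B_k`, `S` a good `q`-set of zeros of `b`, via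
`rootedCovering`.) [cite: Srinivasan2023, Lemma 1.1 (Hegedűs's lemma)] -/
theorem layerGrowth :
    ∀ n j d k : ℕ, d < 2 ^ j → k + 2 * 2 ^ j ≤ n → ∀ g : CubeFn (ZMod 2) n, g ∈ lowDeg (ZMod 2) n d →
      (univ.filter fun u : Fin n → Bool => g u ≠ 0 ∧ wt u = k).card * Nat.choose (n - k) (2 ^ j) ≤
        (univ.filter fun u : Fin n → Bool => g u ≠ 0 ∧ wt u = k + 2 ^ j).card *
          Nat.choose (k + 2 ^ j) (2 ^ j) * Nat.choose (2 * 2 ^ j) (2 ^ j) := by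
  intro n j d k hd hkn g hg
  classical
  set q := 2 ^ j with hq
  have hq1 : 1 ≤ q := Nat.one_le_two_pow
  set Bk := univ.filter fun u : Fin n → Bool => g u ≠ 0 ∧ wt u = k with hBk
  set Bkq := univ.filter fun u : Fin n → Bool => g u ≠ 0 ∧ wt u = k + q with hBkq
  -- flipping a set of coordinates to `true`
  let flip : (Fin n → Bool) → Finset (Fin n) → (Fin n → Bool) := fun b S i => if i ∈ S then true else b i
  let zeros : (Fin n → Bool) → Finset (Fin n) := fun b => univ.filter fun i => b i = false
  let good : (Fin n → Bool) → Finset (Finset (Fin n)) :=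
    fun b => (powersetCard q (zeros b)).filter fun S => g (flip b S) ≠ 0
  have hzeros_card : ∀ b ∈ Bk, (zeros b).card = n - k := by
    intro b hb
    have hwt : wt b = k := (Finset.mem_filter.1 hb).2.2
    have := wt_add_card_false n b
    show (univ.filter fun i => b i = false).card = n - k
    omega
  -- Step 1: every `b ∈ B_k` has at least `C(n−k, q)/C(2q, q)` good `q`-sets
  have hstep1 : ∀ b ∈ Bk, (n - k).choose q ≤ (good b).card * (2 * q).choose q := by
    intro b hb
    have hgb : g b ≠ 0 := (Finset.mem_filter.1 hb).2.1
    set z := n - k with hz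
    have hzq : 2 * q ≤ z := by omega
    set PZ := powersetCard (2 * q) (zeros b) with hPZ
    -- (i) every `2q`-set of zeros contains a good `q`-set
    have hcover : ∀ Z ∈ PZ, 1 ≤ ((good b).filter fun S => S ⊆ Z).card := by
      intro Z hZ
      rw [Finset.mem_powersetCard] at hZ
      obtain ⟨S, hSZ, hS, hgS⟩ := rootedCovering n j d hd g hg b hgb Z
        (fun i hi => (Finset.mem_filter.1 (hZ.1 hi)).2) hZ.2
      refine Finset.card_pos.2 ⟨S, Finset.mem_filter.2 ⟨Finset.mem_filter.2 ⟨?_, hgS⟩, hSZ⟩⟩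
      exact Finset.mem_powersetCard.2 ⟨hSZ.trans hZ.1, hS⟩
    -- (ii) a `q`-set lies in at most `C(z − q, q)` of the `2q`-sets
    have hfibre : ∀ S ∈ good b, (PZ.filter fun Z => S ⊆ Z).card ≤ (z - q).choose q := by
      intro S hS
      have hS' := (Finset.mem_powersetCard.1 (Finset.mem_filter.1 hS).1)
      have htarget : ((zeros b) \ S).card = z - q := by
        rw [Finset.card_sdiff_of_subset hS'.1, hzeros_card b hb, hS'.2]
      rw [← htarget, ← Finset.card_powersetCard]
      refine Finset.card_le_card_of_injOn (fun Z => Z \ S) (fun Z hZ => ?_) (fun Z hZ Z' hZ' h => ?_)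
      · have hZ' := Finset.mem_filter.1 (Finset.mem_coe.1 hZ)
        have hZ1 := Finset.mem_powersetCard.1 hZ'.1
        refine Finset.mem_coe.2 (Finset.mem_powersetCard.2 ⟨Finset.sdiff_subset_sdiff hZ1.1 le_rfl, ?_⟩)
        rw [Finset.card_sdiff_of_subset hZ'.2, hZ1.2, hS'.2]
        omega
      · have h1 := (Finset.mem_filter.1 (Finset.mem_coe.1 hZ)).2
        have h2 := (Finset.mem_filter.1 (Finset.mem_coe.1 hZ')).2
        have h' : Z \ S = Z' \ S := h
        have : Z = (Z \ S) ∪ S := (Finset.sdiff_union_of_subset h1).symm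
        rw [this, h', Finset.sdiff_union_of_subset h2]
    -- double count the pairs `(Z, S)` with `S ⊆ Z`
    have hcount : PZ.card ≤ (good b).card * (z - q).choose q := by
      calc PZ.card = ∑ Z ∈ PZ, 1 := by rw [Finset.card_eq_sum_ones]
        _ ≤ ∑ Z ∈ PZ, ((good b).filter fun S => S ⊆ Z).card := Finset.sum_le_sum hcover
        _ = ∑ Z ∈ PZ, ∑ S ∈ good b, (if S ⊆ Z then 1 else 0) := by
            refine Finset.sum_congr rfl fun Z _ => ?_
            rw [Finset.card_filter]
        _ = ∑ S ∈ good b, ∑ Z ∈ PZ, (if S ⊆ Z then 1 else 0) := Finset.sum_comm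
        _ = ∑ S ∈ good b, (PZ.filter fun Z => S ⊆ Z).card := by
            refine Finset.sum_congr rfl fun S _ => ?_
            rw [Finset.card_filter]
        _ ≤ ∑ S ∈ good b, (z - q).choose q := Finset.sum_le_sum hfibre
        _ = (good b).card * (z - q).choose q := by rw [Finset.sum_const, smul_eq_mul]
    rw [hPZ, Finset.card_powersetCard, hzeros_card b hb] at hcount
    -- `C(z,2q)·C(2q,q) = C(z,q)·C(z−q,q)`, cancel `C(z−q,q) > 0`
    have hid : z.choose (2 * q) * (2 * q).choose q = z.choose q * (z - q).choose (2 * q - q) :=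
      Nat.choose_mul (by omega)
    have h2q : 2 * q - q = q := by omega
    rw [h2q] at hid
    have hpos : 0 < (z - q).choose q := Nat.choose_pos (by omega)
    have h3 : z.choose q * (z - q).choose q ≤ (good b).card * (2 * q).choose q * (z - q).choose q := by
      calc z.choose q * (z - q).choose q = z.choose (2 * q) * (2 * q).choose q := hid.symm
        _ ≤ (good b).card * (z - q).choose q * (2 * q).choose q := Nat.mul_le_mul_right _ hcount
        _ = (good b).card * (2 * q).choose q * (z - q).choose q := by ring
    exact Nat.le_of_mul_le_mul_right h3 hpos
  -- Step 2: `(b, S) ↦ b + 1_S` lands in `B_{k+q}` with fibres of size `≤ C(k+q, q)`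
  set Pairs := Bk.sigma good with hPairs
  let tgt : (Σ _ : Fin n → Bool, Finset (Fin n)) → (Fin n → Bool) := fun p => flip p.1 p.2
  have hmem_good : ∀ {b : Fin n → Bool} {S : Finset (Fin n)}, S ∈ good b →
      S ⊆ zeros b ∧ S.card = q ∧ g (flip b S) ≠ 0 := by
    intro b S hS
    have h1 := Finset.mem_filter.1 hS
    have h2 := Finset.mem_powersetCard.1 h1.1
    exact ⟨h2.1, h2.2, h1.2⟩
  have htgt : ∀ p ∈ Pairs, tgt p ∈ Bkq := by
    intro p hp
    obtain ⟨hb, hS⟩ := Finset.mem_sigma.1 hp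
    obtain ⟨hSz, hSc, hgS⟩ := hmem_good hS
    have hzero : ∀ i ∈ p.2, p.1 i = false := fun i hi => (Finset.mem_filter.1 (hSz hi)).2
    refine Finset.mem_filter.2 ⟨Finset.mem_univ _, hgS, ?_⟩
    show wt (fun i => if i ∈ p.2 then true else p.1 i) = k + q
    rw [wt_flip_eq_add hzero, (Finset.mem_filter.1 hb).2.2, hSc]
  have hfib : ∀ c ∈ Pairs.image tgt, (Pairs.filter fun p => tgt p = c).card ≤ (k + q).choose q := by
    intro c hc
    obtain ⟨p0, hp0, rfl⟩ := Finset.mem_image.1 hc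
    have hcwt : wt (tgt p0) = k + q := (Finset.mem_filter.1 (htgt p0 hp0)).2.2
    -- inject the fibre into the `q`-subsets of the ones of `c`
    have hones : (univ.filter fun i : Fin n => tgt p0 i = true).card = k + q := hcwt
    rw [← hones, ← Finset.card_powersetCard]
    refine Finset.card_le_card_of_injOn (fun p => p.2) (fun p hp => ?_) (fun p hp p' hp' h => ?_)
    · have hp' := Finset.mem_filter.1 (Finset.mem_coe.1 hp)
      obtain ⟨-, hS⟩ := Finset.mem_sigma.1 hp'.1
      obtain ⟨-, hSc, -⟩ := hmem_good hS
      refine Finset.mem_coe.2 (Finset.mem_powersetCard.2 ⟨fun i hi => ?_, hSc⟩)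
      refine Finset.mem_filter.2 ⟨Finset.mem_univ _, ?_⟩
      rw [← hp'.2]
      show (if i ∈ p.2 then true else p.1 i) = true
      rw [if_pos hi]
    · -- `b` is determined by `c` and `S`
      have hp1 := Finset.mem_filter.1 (Finset.mem_coe.1 hp)
      have hp2 := Finset.mem_filter.1 (Finset.mem_coe.1 hp')
      obtain ⟨-, hS⟩ := Finset.mem_sigma.1 hp1.1
      obtain ⟨-, hS'⟩ := Finset.mem_sigma.1 hp2.1
      obtain ⟨hSz, -, -⟩ := hmem_good hS
      obtain ⟨hSz', -, -⟩ := hmem_good hS'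
      have h : p.2 = p'.2 := h
      have hval : ∀ i, p.1 i = p'.1 i := by
        intro i
        have hc := congrFun (hp1.2.trans hp2.2.symm) i
        change (if i ∈ p.2 then true else p.1 i) = (if i ∈ p'.2 then true else p'.1 i) at hc
        by_cases hi : i ∈ p.2
        · have hi' : i ∈ p'.2 := h ▸ hi
          rw [(Finset.mem_filter.1 (hSz hi)).2, (Finset.mem_filter.1 (hSz' hi')).2]
        · have hi' : i ∉ p'.2 := fun h' => hi (h ▸ h')
          rwa [if_neg hi, if_neg hi'] at hc
      exact Sigma.ext (funext hval) (heq_of_eq h)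
  have hstep2 : Pairs.card ≤ (k + q).choose q * Bkq.card := by
    calc Pairs.card ≤ (k + q).choose q * (Pairs.image tgt).card := Finset.card_le_mul_card_image _ _ hfib
      _ ≤ (k + q).choose q * Bkq.card :=
          Nat.mul_le_mul_left _ (Finset.card_le_card (Finset.image_subset_iff.2 htgt))
  -- Step 3: combine
  have hsum : Bk.card * (n - k).choose q ≤ Pairs.card * (2 * q).choose q := by
    calc Bk.card * (n - k).choose q = ∑ b ∈ Bk, (n - k).choose q := by rw [Finset.sum_const, smul_eq_mul]
      _ ≤ ∑ b ∈ Bk, (good b).card * (2 * q).choose q := Finset.sum_le_sum hstep1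
      _ = Pairs.card * (2 * q).choose q := by rw [hPairs, Finset.card_sigma, Finset.sum_mul]
  calc Bk.card * (n - k).choose q ≤ Pairs.card * (2 * q).choose q := hsum
    _ ≤ (k + q).choose q * Bkq.card * (2 * q).choose q := Nat.mul_le_mul_right _ hstep2
    _ = Bkq.card * (k + q).choose q * (2 * q).choose q := by ring

end Summit.QuantumAdvantage.AdviceFreeQNC0
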